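import Summits.CriticalPhenomena.PercolationContinuityZ3.Theorems.PercNearOneGluingNoHeavyPcintMeanMemCharge
import HarnessLib

/-!
# PCINT lane, reduction B3m on the memory-`τ` DANGEROUS-SET automaton — booking the on-path charges on the chords

Cell `prim-pcint` (PAPER-2 track (iii): certified intervals for `p_c(ℤ^d)`), seat `prim-pcint-2` (gen 4); support file
(`--supports stmt-CriticalPhenomena-4575`).  Does NOT build on p205010.  Memo: `run/shared/lean/prim/pcint/REDUCTIONS.md` §B3m.

Three-unit version of `…ThirdMemBook`: an on-path charge `chargeF3` is at least `s^{ecs3} t^{ect3}` (the corner-third unit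
`m ≥ t` is booked as a `t`-unit), and with the per-incidence injectivity of `…ThirdMemBook` (`units_prefix_le`) the charges at a
future vertex `v_h` total at most `kp h + 1` units with at most `kp h - 1` discounted ones, so their product is
`≥ s² t^{kp h - 1}` (`prod_chargeF3_future_ge`); every charge is `≥ s t` (`chargeF3_ge_st`).
-/

noncomputable section

namespace Summit.CriticalPhenomena.PercolationContinuityZ3.Theorems.Pcint

open Finset Literature.Probability.Percolation Literature.Probability.LatticeModels ChainBond

variable {d : ℕ} (a₀ : Fin d × Bool) {τ kc n : ℕ} {γ : Fin n → Fin d × Bool}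

namespace ChainBond

/-- `uFt + uF3` vanishes below index `2` and is at most `1`. [folklore] -/
theorem uFt_add_uF3_incAt_le {kc : ℕ} (γ : Fin n → Fin d × Bool) (w : Site d) {k : ℕ} (hk : k < (incTimes γ w).card) :
    uFt kc γ w (incAt γ w k) + uF3 kc γ w (incAt γ w k) ≤ if 2 ≤ k then 1 else 0 := by
  classical
  unfold uFt uF3
  rw [← card_union_of_disjoint (disjoint_filter_filter (disjoint_tSet_c3Set kc γ w))]
  split_ifs with h2
  · refine card_le_one.2 fun j hj j' hj' => ?_
    have key : ∀ {j}, j ∈ (tSet kc γ w).filter (fun k' => incAt γ w k' = incAt γ w k) ∪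
        (c3Set kc γ w).filter (fun k' => incAt γ w k' = incAt γ w k) → j = k := by
      intro j hj
      rcases mem_union.1 hj with hj | hj
      · obtain ⟨h1, h2⟩ := mem_filter.1 hj
        exact incAt_inj (mem_tSet.1 h1).1.2.1 hk h2
      · obtain ⟨h1, h2⟩ := mem_filter.1 hj
        exact incAt_inj (mem_c3Set.1 h1).1.2.1 hk h2
    rw [key hj, key hj']
  · rw [Nat.le_zero, card_eq_zero, ← disjUnion_eq_union _ _ (disjoint_filter_filter (disjoint_tSet_c3Set kc γ w)),
      disjUnion_eq_union, union_eq_empty, filter_eq_empty_iff, filter_eq_empty_iff]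
    constructor
    · intro j hj hje
      have hj' := mem_tSet.1 hj
      have := incAt_inj hj'.1.2.1 hk hje
      have := hj'.2.1; omega
    · intro j hj hje
      have hj' := mem_c3Set.1 hj
      have := incAt_inj hj'.1.2.1 hk hje
      have := hj'.2.1; omega

end ChainBond

/-! ### The exponents of a charge -/

section Charges

open Classical

variable {s tv mv : ℝ}

/-- The `s`-exponent of the B3m charge at the site `x` at step `t`. [folklore] -/
def ecs3 (τ kc : ℕ) (γ : Fin n → Fin d × Bool) (t : ℕ) (x : Site d) : ℕ :=
  if ht : t < n then
    (if x - wordPos γ t ∈ cdetSet kc (danger τ (pre a₀ γ t)) (γ ⟨t, ht⟩) then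
        uA τ kc (danger τ (pre a₀ γ t)) (x - wordPos γ t) - uAt kc (danger τ (pre a₀ γ t)) (γ ⟨t, ht⟩) (x - wordPos γ t) -
          uA3 kc (danger τ (pre a₀ γ t)) (γ ⟨t, ht⟩) (x - wordPos γ t)
      else 0) +
      (if bcorner (danger τ (pre a₀ γ t)) (γ ⟨t, ht⟩) = true ∧ cornerSite γ (t - 1) = x then 2 else 0)
  else 0

/-- The discounted-unit exponent (`t`-units and corner-third units) of the B3m charge at the site `x` at step `t`. [folklore] -/
def ect3 (τ kc : ℕ) (γ : Fin n → Fin d × Bool) (t : ℕ) (x : Site d) : ℕ :=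
  if ht : t < n then
    (if x - wordPos γ t ∈ cdetSet kc (danger τ (pre a₀ γ t)) (γ ⟨t, ht⟩) then
      uAt kc (danger τ (pre a₀ γ t)) (γ ⟨t, ht⟩) (x - wordPos γ t) + uA3 kc (danger τ (pre a₀ γ t)) (γ ⟨t, ht⟩) (x - wordPos γ t)
    else 0)
  else 0

/-- A det-paying site is not the claimed corner site. [folklore] -/
theorem not_corner_of_mem_cdetSet {t : ℕ} (ht : t < n) {x : Site d}
    (hD : x - wordPos γ t ∈ cdetSet kc (danger τ (pre a₀ γ t)) (γ ⟨t, ht⟩)) :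
    ¬ (bcorner (danger τ (pre a₀ γ t)) (γ ⟨t, ht⟩) = true ∧ cornerSite γ (t - 1) = x) := by
  rintro ⟨hc, hCx⟩
  obtain ⟨-, -, -, -, -, -, -, hfree⟩ := bcorner_spec a₀ ht hc
  rw [cdetSet, mem_filter] at hD
  obtain ⟨-, -, -, ⟨q, hq, hq2⟩, -⟩ := hD
  rw [← hCx] at hq
  exact hfree q (mem_bcinc.1 hq).1 hq2 (mem_bcinc.1 hq).2

/-- **A B3m charge is at least `s^{ecs3} t^{ect3}`** (`0 ≤ t ≤ m`, `0 ≤ s`). [folklore] -/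
theorem chargeF3_ge_pow (hs0 : 0 ≤ s) (ht0 : 0 ≤ tv) (htm : tv ≤ mv) (t : ℕ) (x : Site d) :
    s ^ ecs3 a₀ τ kc γ t x * tv ^ ect3 a₀ τ kc γ t x ≤ chargeF3 a₀ s tv mv τ kc γ t x := by
  unfold chargeF3 ecs3 ect3
  by_cases ht : t < n
  · rw [dif_pos ht, dif_pos ht, dif_pos ht]
    by_cases hD : x - wordPos γ t ∈ cdetSet kc (danger τ (pre a₀ γ t)) (γ ⟨t, ht⟩)
    · have hnc := not_corner_of_mem_cdetSet a₀ (kc := kc) ht hD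
      rw [if_pos hD, if_pos hD, if_pos hD, if_neg hnc, if_neg hnc, mul_one, add_zero, siteF3, pow_add]
      have hm0 := ht0.trans htm
      have : tv ^ uA3 kc (danger τ (pre a₀ γ t)) (γ ⟨t, ht⟩) (x - wordPos γ t) ≤
          mv ^ uA3 kc (danger τ (pre a₀ γ t)) (γ ⟨t, ht⟩) (x - wordPos γ t) := pow_le_pow_left₀ ht0 htm _
      calc _ = s ^ (uA τ kc (danger τ (pre a₀ γ t)) (x - wordPos γ t) - uAt kc (danger τ (pre a₀ γ t)) (γ ⟨t, ht⟩) (x - wordPos γ t) -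
            uA3 kc (danger τ (pre a₀ γ t)) (γ ⟨t, ht⟩) (x - wordPos γ t)) *
            tv ^ uAt kc (danger τ (pre a₀ γ t)) (γ ⟨t, ht⟩) (x - wordPos γ t) *
            tv ^ uA3 kc (danger τ (pre a₀ γ t)) (γ ⟨t, ht⟩) (x - wordPos γ t) := by ring
        _ ≤ _ := mul_le_mul_of_nonneg_left this (by positivity)
    · rw [if_neg hD, if_neg hD, if_neg hD, one_mul, zero_add, pow_zero, mul_one]
      split_ifs <;> simp
  · rw [dif_neg ht, dif_neg ht, dif_neg ht, pow_zero, pow_zero, mul_one]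

/-- Exponent bounds of a charge: `ect3 ≤ 1`, `ecs3 + ect3 ≤ 2`. [folklore] -/
theorem ecs3_add_ect3_le (t : ℕ) (x : Site d) : ect3 a₀ τ kc γ t x ≤ 1 ∧ ecs3 a₀ τ kc γ t x + ect3 a₀ τ kc γ t x ≤ 2 := by
  unfold ecs3 ect3
  by_cases ht : t < n
  · rw [dif_pos ht, dif_pos ht]
    by_cases hD : x - wordPos γ t ∈ cdetSet kc (danger τ (pre a₀ γ t)) (γ ⟨t, ht⟩)
    · have hnc := not_corner_of_mem_cdetSet a₀ (kc := kc) ht hD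
      rw [if_pos hD, if_pos hD, if_neg hnc]
      have h1 := uA_le_two τ kc (danger τ (pre a₀ γ t)) (x - wordPos γ t)
      have h2 := uAt_add_uA3_le τ kc (danger τ (pre a₀ γ t)) (γ ⟨t, ht⟩) (x - wordPos γ t)
      omega
    · rw [if_neg hD, if_neg hD]; split_ifs <;> omega
  · rw [dif_neg ht, dif_neg ht]; omega

/-- **Every on-path charge is at least `s·t`.** [folklore] -/
theorem chargeF3_ge_st (hs0 : 0 ≤ s) (hs1 : s ≤ 1) (ht0 : 0 ≤ tv) (htm : tv ≤ mv) (hms : mv ≤ s) (t : ℕ) (x : Site d) :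
    s * tv ≤ chargeF3 a₀ s tv mv τ kc γ t x := by
  refine le_trans ?_ (chargeF3_ge_pow a₀ hs0 ht0 htm t x)
  have hts : tv ≤ s := htm.trans hms
  obtain ⟨h1, h2⟩ := ecs3_add_ect3_le a₀ (τ := τ) (kc := kc) (γ := γ) t x
  rcases Nat.lt_or_ge (ect3 a₀ τ kc γ t x) 1 with hj | hj
  · have hj0 : ect3 a₀ τ kc γ t x = 0 := by omega
    rw [hj0, pow_zero, mul_one]
    calc s * tv ≤ s * s := mul_le_mul_of_nonneg_left hts hs0
      _ = s ^ 2 := by ring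
      _ ≤ s ^ ecs3 a₀ τ kc γ t x := pow_le_pow_of_le_one hs0 hs1 (by omega)
  · have hj1 : ect3 a₀ τ kc γ t x = 1 := by omega
    rw [hj1, pow_one]
    refine mul_le_mul_of_nonneg_right ?_ ht0
    rcases Nat.eq_zero_or_pos (ecs3 a₀ τ kc γ t x) with h0 | h0
    · rw [h0, pow_zero]; exact hs1
    · calc s = s ^ 1 := (pow_one s).symm
        _ ≤ s ^ ecs3 a₀ τ kc γ t x := pow_le_pow_of_le_one hs0 hs1 (by omega)

end Charges

/-! ### Booking at a future vertex -/

section Future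

open Classical

variable {s tv mv : ℝ}

/-- **The future charges at `v_h` total at most `kp h + 1` units.** [folklore] -/
theorem sum_units3_future_le (hτ : kc + 4 ≤ τ) (hkc : 2 ≤ kc) {h : ℕ} (h1 : 1 ≤ h) (hn : h ≤ n) :
    ∑ th ∈ futureEv τ γ h, (ecs3 a₀ τ kc γ th.1 (wordPos γ h) + ect3 a₀ τ kc γ th.1 (wordPos γ h)) ≤ kp γ h + 1 := by
  -- the exponent sum of a B3m charge equals that of the B3t charge (`ecs + ect`)
  have heq : ∀ th ∈ futureEv τ γ h, ecs3 a₀ τ kc γ th.1 (wordPos γ h) + ect3 a₀ τ kc γ th.1 (wordPos γ h) =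
      ecs a₀ τ kc γ th.1 (wordPos γ h) + ect a₀ τ kc γ th.1 (wordPos γ h) := by
    intro th hth
    have htn := (mem_onEventsR.1 (mem_filter.1 hth).1).1
    unfold ecs3 ect3 ecs ect
    rw [dif_pos htn, dif_pos htn, dif_pos htn, dif_pos htn]
    by_cases hD : wordPos γ h - wordPos γ th.1 ∈ cdetSet kc (danger τ (pre a₀ γ th.1)) (γ ⟨th.1, htn⟩)
    · rw [if_pos hD, if_pos hD, if_pos hD, if_pos hD]
      have h2 := uAt_add_uA3_le τ kc (danger τ (pre a₀ γ th.1)) (γ ⟨th.1, htn⟩) (wordPos γ h - wordPos γ th.1)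
      omega
    · rw [if_neg hD, if_neg hD, if_neg hD, if_neg hD]
  rw [sum_congr rfl heq]
  exact sum_units_future_le a₀ hτ hkc h1 hn

/-- **At most `kp h - 1` future discounted units at `v_h`.** [folklore] -/
theorem sum_tunits3_future_le (hτ : kc + 4 ≤ τ) (hkc : 2 ≤ kc) {h : ℕ} (h1 : 1 ≤ h) (hn : h ≤ n) :
    ∑ th ∈ futureEv τ γ h, ect3 a₀ τ kc γ th.1 (wordPos γ h) ≤ kp γ h - 1 := by
  set x := wordPos γ h with hx
  obtain ⟨hkpr, hkph⟩ := incAt_kp (γ := γ) h1 hn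
  have hev : ∀ th ∈ futureEv τ γ h, ect3 a₀ τ kc γ th.1 x ≤ uFt kc γ x (th.1 + 1) + uF3 kc γ x (th.1 + 1) := by
    intro th hth
    have htn := (mem_onEventsR.1 (mem_filter.1 hth).1).1
    unfold ect3
    rw [dif_pos htn]
    split_ifs with hD
    · unfold uAt uA3
      have e : x - wordPos γ th.1 + wordPos γ th.1 = x := sub_add_cancel _ _
      refine add_le_add ?_ ?_
      · split_ifs with hT
        · have := one_le_uFt_of_mem_ctSet a₀ hτ hkc htn hT; rw [e] at this; exact this
        · exact Nat.zero_le _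
      · split_ifs with hM
        · have := one_le_uF3_of_mem_cm3Set a₀ hkc htn hM; rw [e] at this; exact this
        · exact Nat.zero_le _
    · exact Nat.zero_le _
  refine (sum_le_sum hev).trans ?_
  have hKinj : Set.InjOn (fun th : ℕ × ℕ => th.1 + 1) ↑(futureEv τ γ h) := by
    intro th hth th' hth' e
    have h2 := (mem_filter.1 (mem_coe.1 hth)).2.1
    have h2' := (mem_filter.1 (mem_coe.1 hth')).2.1
    exact Prod.ext (by simpa using e) (h2.trans h2'.symm)
  rw [← sum_image (f := fun T => uFt kc γ x T + uF3 kc γ x T) (g := fun th : ℕ × ℕ => th.1 + 1) hKinj]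
  set K := (futureEv τ γ h).image fun th => th.1 + 1 with hK
  have hKsub : K ⊆ (range (kp γ h + 1)).image (incAt γ x) := by
    intro T hT
    obtain ⟨th, hth, rfl⟩ := mem_image.1 hT
    obtain ⟨k, hk, hkT, hkle, -⟩ := futureEv_index (γ := γ) hth
    exact mem_image.2 ⟨k, mem_range.2 (by omega), hkT⟩
  have hinjI : Set.InjOn (incAt γ x) ↑(range (kp γ h + 1)) := fun j hj j' hj' e =>
    incAt_inj (lt_of_lt_of_le (mem_range.1 (mem_coe.1 hj)) hkpr) (lt_of_lt_of_le (mem_range.1 (mem_coe.1 hj')) hkpr) e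
  have hterm : ∀ k ∈ range (kp γ h + 1), uFt kc γ x (incAt γ x k) + uF3 kc γ x (incAt γ x k) ≤ if 2 ≤ k then 1 else 0 :=
    fun k hk => uFt_add_uF3_incAt_le γ x (lt_of_lt_of_le (mem_range.1 hk) hkpr)
  have hcount : ((range (kp γ h + 1)).filter fun k => 2 ≤ k).card ≤ kp γ h - 1 := by
    have := card_le_card_of_injOn (s := (range (kp γ h + 1)).filter fun k => 2 ≤ k) (t := range (kp γ h - 1))
      (fun k => k - 2) (fun k hk => by
        obtain ⟨hk1, hk2⟩ := mem_filter.1 (mem_coe.1 hk)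
        rw [mem_coe, mem_range]; have := mem_range.1 hk1; show k - 2 < kp γ h - 1; omega)
      (fun k hk k' hk' e => by
        have h2 := (mem_filter.1 (mem_coe.1 hk)).2
        have h2' := (mem_filter.1 (mem_coe.1 hk')).2
        simp only at e; omega)
    rwa [card_range] at this
  calc ∑ T ∈ K, (uFt kc γ x T + uF3 kc γ x T)
      ≤ ∑ T ∈ (range (kp γ h + 1)).image (incAt γ x), (uFt kc γ x T + uF3 kc γ x T) := sum_le_sum_of_subset hKsub
    _ = ∑ k ∈ range (kp γ h + 1), (uFt kc γ x (incAt γ x k) + uF3 kc γ x (incAt γ x k)) := sum_image hinjI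
    _ ≤ ∑ k ∈ range (kp γ h + 1), (if 2 ≤ k then 1 else 0) := sum_le_sum hterm
    _ = ((range (kp γ h + 1)).filter fun k => 2 ≤ k).card := by rw [sum_boole, Nat.cast_id]
    _ ≤ kp γ h - 1 := hcount

/-- **The future charges at `v_h` multiply to at least `s² t^{kp h - 1}`** (or `1` if `kp h = 0`). [folklore] -/
theorem prod_chargeF3_future_ge (hτ : kc + 4 ≤ τ) (hkc : 2 ≤ kc) (hs0 : 0 ≤ s) (hs1 : s ≤ 1) (ht0 : 0 ≤ tv)
    (htm : tv ≤ mv) (hms : mv ≤ s) {h : ℕ} (hn : h ≤ n) :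
    (if 1 ≤ kp γ h then s ^ 2 * tv ^ (kp γ h - 1) else 1) ≤
      ∏ th ∈ futureEv τ γ h, chargeF3 a₀ s tv mv τ kc γ th.1 (wordPos γ h) := by
  have hts : tv ≤ s := htm.trans hms
  by_cases hE : futureEv τ γ h = ∅
  · rw [hE, prod_empty]
    split_ifs
    · exact mul_le_one₀ (pow_le_one₀ hs0 hs1) (pow_nonneg ht0 _) (pow_le_one₀ ht0 (hts.trans hs1))
    · exact le_rfl
  obtain ⟨th0, hth0⟩ := nonempty_iff_ne_empty.2 hE
  have h1 : 1 ≤ h := by have := (mem_filter.1 hth0).2.2; omega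
  obtain ⟨k0, -, -, hk0le, hk01⟩ := futureEv_index (γ := γ) hth0
  have hkp1 : 1 ≤ kp γ h := by omega
  rw [if_pos hkp1]
  refine le_trans ?_ (prod_le_prod (fun th _ => by positivity) fun th _ => chargeF3_ge_pow a₀ hs0 ht0 htm th.1 (wordPos γ h))
  rw [prod_mul_distrib, prod_pow_eq_pow_sum, prod_pow_eq_pow_sum]
  have hA := sum_units3_future_le a₀ (γ := γ) hτ hkc h1 hn
  have hB := sum_tunits3_future_le a₀ (γ := γ) hτ hkc h1 hn
  rw [sum_add_distrib] at hA
  exact spow_tpow_le hs1 ht0 hts hB (by omega)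

end Future

end Summit.CriticalPhenomena.PercolationContinuityZ3.Theorems.Pcint
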